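import Mathlib.NumberTheory.Cyclotomic.PrimitiveRoots
import Mathlib.NumberTheory.NumberField.Units.Basic
import Mathlib.FieldTheory.Galois.Basic
import Mathlib.Data.ZMod.Basic
import HarnessLib

/-!
# Chevalley 1951, Théorème 1 for units — descent of `p^t`-th powers from `K(ζ_{p^t})` to `K` (proofs file, 2/3)

Sibling proofs file of `ChevalleyUnitCongruence.lean` (named fact
`Literature.NumberTheory.NumberFields.Chevalley1951.thm1_units`, C. Chevalley, *Deux théorèmes
d'arithmétique*, J. Math. Soc. Japan **3** (1951) 36–44 [ChevalleyDeuxTheoremes1951]).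
Theorems only: no `sorry`, no new definition, no new named fact (D-0026).

This file formalises §4 of the paper (pp. 38–39) — the reduction "on peut se ramener au cas où
`K` contient une racine `m`-ième primitive de l'unité", i.e. the **Remarque** printed on p. 39:

> "Soient `p` un nombre premier, `m = p^e` une puissance de `p`, et `K` un corps qui n'est pas de
> caractéristique `p`; supposons de plus que `-1` soit un carré dans `K` si `p = 2`.  Si `ζ` est
> une racine primitive `m`-ième de l'unité, tout élément de `K` qui est puissance `m`-ième dans
> `K(ζ)` l'est déjà dans `K`."

in the following **weak form**, which is what the unit theorem needs and which avoids the
hypothesis "`-1` carré si `p = 2`" (Chevalley's §3): for `t ≥ 2`, an element `x ∈ K` which is a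
`p^t`-th power in `K(ζ_{p^t})` satisfies `x = ± w^{p^{t-1}}` for some `w ∈ K`
(`Chevalley1951.exists_eq_pow_or_eq_neg_pow_of_mem_adjoin`); for a unit `x` of the ring of
integers of a number field, `w` is again a unit (`Chevalley1951.exists_unit_eq_torsion_mul_pow`).

The proof is Chevalley's, step for step (p. 38): writing `ζ_h = ζ^{p^{t-h}}`, one descends an
`m`-th root `y` of `x` along the tower `K(ζ_h) ⊆ K(ζ_{h+1})` for `h ≥ 1` (`h ≥ 2` if `p = 2`)
— `Chevalley1951.descent_step`: if `K(ζ_{h+1}) ≠ K(ζ_h)` pick `s ∈ Gal(L/K(ζ_h))` moving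
`ζ_{h+1}`; then `θ = s ζ_{h+1}/ζ_{h+1}` is a primitive `p`-th root of unity, `s y = ζ^f y`,
`s ζ = ζ^g` with `g ≡ 1 (mod p^h)`, and `s^p y = y` gives `p^t ∣ f (1 + g + ⋯ + g^{p-1})`; since
"`1 + g + ⋯ + g^{p-1} ≡ p (mod p^2)`, d'où `f ≡ 0 (mod p^{e-1})`"
(`Chevalley1951.geom_sum_eq_prime_mul_coprime`), `ζ^f` is a `p`-th root of unity `θ^j` and
`y ζ_{h+1}^{-j}` is fixed by `Gal(L/K(ζ_h))` — down to `K(ζ_p)` (resp. `K(ζ_4)`), and finishes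
with a norm to `K`: `[K(ζ_p) : K] ≤ p - 1` is prime to `p` (Bezout), resp. `[K(ζ_4) : K] ≤ 2`
gives `x^2 = z^{2^t}`, `x = ± z^{2^{t-1}}`.  Everything takes place inside an ambient finite Galois
extension `L/K` containing `ζ` (in the application, a splitting field).

## References

* C. Chevalley, *Deux théorèmes d'arithmétique*, J. Math. Soc. Japan 3 (1951) 36–44, §4
  (pp. 38–39) and the Remarque p. 39. [ChevalleyDeuxTheoremes1951]
-/

noncomputable section

open scoped Classical IntermediateField

namespace Literature.NumberTheory.NumberFields

/-! ### The arithmetic of `1 + g + ⋯ + g^{p-1}` for `g ≡ 1 (mod p^h)` -/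

/-- **"`1 + g + ⋯ + g^{p-1} ≡ p (mod p²)`"** (Chevalley, p. 38): for a prime `p`, `h ≥ 1`
(`h ≥ 2` if `p = 2`) and `g ≡ 1 (mod p^h)`, the sum `1 + g + ⋯ + g^{p-1}` is `p` times an
integer prime to `p`. [cite: ChevalleyDeuxTheoremes1951, §4 (p. 38)] -/
theorem Chevalley1951.geom_sum_eq_prime_mul_coprime {p g h : ℕ} (hp : p.Prime) (hh : 1 ≤ h)
    (hh2 : p = 2 → 2 ≤ h) (hg : g ≡ 1 [MOD p ^ h]) :
    ∃ S : ℕ, (∑ i ∈ Finset.range p, g ^ i) = p * S ∧ S.Coprime p := by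
  have hp1 : 1 < p := hp.one_lt
  have hph : 1 < p ^ h := Nat.one_lt_pow (by omega) hp1
  -- `g = 1 + p^h c`
  have hg1 : 1 ≤ g := by
    rcases Nat.eq_zero_or_pos g with rfl | hpos
    · exfalso
      rw [Nat.ModEq, Nat.zero_mod, Nat.mod_eq_of_lt hph] at hg
      exact absurd hg (by norm_num)
    · exact hpos
  obtain ⟨c, hc⟩ : p ^ h ∣ g - 1 := (Nat.modEq_iff_dvd' hg1).mp hg.symm
  have hgc : g = 1 + p ^ h * c := by omega
  -- the correction term is divisible by `p²`
  have hT : p ^ 2 ∣ (∑ i ∈ Finset.range p, i) * (p ^ h * c) := by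
    rcases hp.eq_two_or_odd' with rfl | hodd
    · have h2 : 2 ≤ h := hh2 rfl
      have hsum : (∑ i ∈ Finset.range 2, i) = 1 := by simp [Finset.sum_range_succ]
      rw [hsum, one_mul]
      exact (pow_dvd_pow 2 h2).trans (dvd_mul_right _ _)
    · have hne : p ≠ 2 := by rintro rfl; exact absurd hodd (by decide)
      have h2T : p ^ 2 ∣ 2 * ((∑ i ∈ Finset.range p, i) * (p ^ h * c)) := by
        rw [← mul_assoc, mul_comm 2, Finset.sum_range_id_mul_two]
        calc p ^ 2 ∣ p * p ^ h := by rw [← pow_succ']; exact pow_dvd_pow p (by omega)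
          _ ∣ p * (p - 1) * (p ^ h * c) := ⟨(p - 1) * c, by ring⟩
      have hcop : Nat.Coprime (p ^ 2) 2 :=
        Nat.Coprime.pow_left 2 ((Nat.coprime_primes hp Nat.prime_two).mpr hne)
      exact hcop.dvd_of_dvd_mul_left h2T
  -- compute the sum in `ZMod (p²)`
  haveI : NeZero (p ^ 2) := ⟨pow_ne_zero _ hp.ne_zero⟩
  set a : ZMod (p ^ 2) := ((p ^ h * c : ℕ) : ZMod (p ^ 2)) with hadef
  have hgR : (g : ZMod (p ^ 2)) = 1 + a := by
    rw [hadef, hgc]; push_cast; ring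
  have ha2 : a * a = 0 := by
    rw [hadef, ← Nat.cast_mul, ZMod.natCast_eq_zero_iff]
    calc p ^ 2 ∣ p ^ h * p ^ h := by rw [← pow_add]; exact pow_dvd_pow p (by omega)
      _ ∣ p ^ h * c * (p ^ h * c) := mul_dvd_mul (dvd_mul_right _ _) (dvd_mul_right _ _)
  have hpow : ∀ i : ℕ, (1 + a) ^ i = 1 + (i : ZMod (p ^ 2)) * a := by
    intro i
    induction i with
    | zero => simp
    | succ i ih =>
      rw [pow_succ (1 + a) i, ih, Nat.cast_succ]
      linear_combination (i : ZMod (p ^ 2)) * ha2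
  have hcast : ((∑ i ∈ Finset.range p, g ^ i : ℕ) : ZMod (p ^ 2)) = (p : ZMod (p ^ 2)) := by
    have h1 : ((∑ i ∈ Finset.range p, g ^ i : ℕ) : ZMod (p ^ 2)) =
        (p : ZMod (p ^ 2)) + ((∑ i ∈ Finset.range p, i : ℕ) : ZMod (p ^ 2)) * a := by
      push_cast
      simp_rw [hgR, hpow]
      rw [Finset.sum_add_distrib, Finset.sum_const, Finset.card_range, Finset.sum_mul,
        nsmul_eq_mul, mul_one]
    have h2 : ((∑ i ∈ Finset.range p, i : ℕ) : ZMod (p ^ 2)) * a = 0 := by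
      rw [hadef, ← Nat.cast_mul, ZMod.natCast_eq_zero_iff]
      exact hT
    rw [h1, h2, add_zero]
  have hSp : (∑ i ∈ Finset.range p, g ^ i) ≡ p [MOD p ^ 2] :=
    (ZMod.natCast_eq_natCast_iff _ _ _).mp hcast
  -- `p ∣ S` and `S / p ≡ 1 (mod p)`
  have hpS : p ∣ ∑ i ∈ Finset.range p, g ^ i := by
    have h1 : (∑ i ∈ Finset.range p, g ^ i) ≡ p [MOD p] :=
      hSp.of_dvd (dvd_pow_self p two_ne_zero)
    exact Nat.modEq_zero_iff_dvd.mp (h1.trans (Nat.modEq_zero_iff_dvd.mpr dvd_rfl))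
  obtain ⟨S, hS⟩ := hpS
  refine ⟨S, hS, ?_⟩
  have h1 : S ≡ 1 [MOD p] := by
    refine Nat.ModEq.mul_left_cancel' hp.ne_zero ?_
    rw [mul_one, ← pow_two, ← hS]
    exact hSp
  rw [Nat.Coprime, h1.gcd_eq, Nat.gcd_one_left]

/-! ### Galois-theoretic helpers inside an ambient finite Galois extension `L/K` -/

section Galois

variable {K L : Type*} [Field K] [Field L] [Algebra K L]

/-- Two `K`-automorphisms of `L` which agree on `α` agree on `K(α)`. [folklore] -/
theorem Chevalley1951.algEquiv_apply_eq_of_apply_gen_eq {α : L} {φ ψ : L ≃ₐ[K] L}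
    (h : φ α = ψ α) {z : L} (hz : z ∈ K⟮α⟯) : φ z = ψ z := by
  have hτ : (ψ⁻¹ * φ) α = α := by
    rw [AlgEquiv.mul_apply, h, ← AlgEquiv.mul_apply, inv_mul_cancel, AlgEquiv.one_apply]
  have hle : K⟮α⟯ ≤ IntermediateField.fixedField (Subgroup.zpowers (ψ⁻¹ * φ)) := by
    rw [IntermediateField.adjoin_simple_le_iff, IntermediateField.mem_fixedField_iff]
    intro f hf
    have hst : Subgroup.zpowers (ψ⁻¹ * φ) ≤ MulAction.stabilizer (L ≃ₐ[K] L) α := by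
      rw [Subgroup.zpowers_le, MulAction.mem_stabilizer_iff, AlgEquiv.smul_def, hτ]
    have hf' := hst hf
    rwa [MulAction.mem_stabilizer_iff, AlgEquiv.smul_def] at hf'
  have hz' := (IntermediateField.mem_fixedField_iff _ _).mp (hle hz) (ψ⁻¹ * φ)
    (Subgroup.mem_zpowers _)
  rw [AlgEquiv.mul_apply] at hz'
  have hz'' := congrArg ψ hz'
  rwa [← AlgEquiv.mul_apply, mul_inv_cancel, AlgEquiv.one_apply] at hz''

/-- A `K`-automorphism of `L` fixing `α` fixes `K(α)` pointwise. [folklore] -/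
theorem Chevalley1951.algEquiv_apply_eq_self_of_apply_gen_eq {α : L} {φ : L ≃ₐ[K] L}
    (h : φ α = α) {z : L} (hz : z ∈ K⟮α⟯) : φ z = z := by
  have h' : φ α = (1 : L ≃ₐ[K] L) α := by rw [AlgEquiv.one_apply, h]
  rw [Chevalley1951.algEquiv_apply_eq_of_apply_gen_eq h' hz, AlgEquiv.one_apply]

/-- Iterating an automorphism that multiplies `α` by a fixed element `θ`. [folklore] -/
theorem Chevalley1951.algEquiv_pow_apply_of_apply_eq_mul {α θ : L} {φ : L ≃ₐ[K] L}
    (hα : φ α = θ * α) (hθ : φ θ = θ) (k : ℕ) : (φ ^ k) α = θ ^ k * α := by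
  induction k with
  | zero => simp
  | succ k ih => rw [pow_succ', AlgEquiv.mul_apply, ih, map_mul, map_pow, hθ, hα, pow_succ]; ring

/-- Iterating an automorphism on a fixed element. [folklore] -/
theorem Chevalley1951.algEquiv_pow_apply_of_apply_eq_self {z : L} {φ : L ≃ₐ[K] L}
    (hz : φ z = z) (k : ℕ) : (φ ^ k) z = z := by
  induction k with
  | zero => simp
  | succ k ih => rw [pow_succ', AlgEquiv.mul_apply, ih, hz]

variable [FiniteDimensional K L] [IsGalois K L]

/-- **Chevalley's descent step** (p. 38: "il suffira de montrer que, s'il est puissance `m`-ième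
dans `K(ζ_{h+1})`, il est aussi puissance `m`-ième dans `K(ζ_h)` (`0 ≤ h < e`)", here for
`h ≥ 1`, and `h ≥ 2` if `p = 2`).  Inside a finite Galois extension `L/K`, let `ζ` be a primitive
`p^{h+1+e}`-th root of unity, `α = ζ^{p^e}` (a primitive `p^{h+1}`-th root) and `β = α^p`.  If
`x ∈ Kˣ` has a `p^{h+1+e}`-th root in `K(α)`, it has one in `K(β)`.  Proof as printed: if
`α ∉ K(β)` choose `s ∈ Gal(L/K(β))` with `s α ≠ α`; `θ = sα/α` is a primitive `p`-th root of
unity in `K(β)`; `s y = ζ^f y`, `s ζ = ζ^g`, `g ≡ 1 (mod p^h)`, `s^p y = y`, so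
`p^{h+1+e} ∣ f (1 + g + ⋯ + g^{p-1})` and `1 + g + ⋯ + g^{p-1} = p · S` with `(S, p) = 1`, whence
`(ζ^f)^p = 1`, `ζ^f = θ^j`, and `y α^{-j}` is fixed by every element of `Gal(L/K(β))`.
[cite: ChevalleyDeuxTheoremes1951, §4 (p. 38)] -/
theorem Chevalley1951.descent_step {p : ℕ} (hp : p.Prime) {h e : ℕ} (hh : 1 ≤ h)
    (hh2 : p = 2 → 2 ≤ h) {ζ : L} (hζ : IsPrimitiveRoot ζ (p ^ (h + 1 + e))) {x : K} (hx : x ≠ 0)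
    {y : L} (hy : y ∈ K⟮ζ ^ p ^ e⟯) (hyx : y ^ p ^ (h + 1 + e) = algebraMap K L x) :
    ∃ y' ∈ K⟮ζ ^ p ^ (e + 1)⟯, y' ^ p ^ (h + 1 + e) = algebraMap K L x := by
  set n := p ^ (h + 1 + e) with hndef
  set α := ζ ^ p ^ e with hαdef
  set β := ζ ^ p ^ (e + 1) with hβdef
  have hαβ : α ^ p = β := by rw [hαdef, hβdef, ← pow_mul, ← pow_succ]
  have hp0 : p ≠ 0 := hp.ne_zero
  haveI : NeZero p := ⟨hp0⟩
  have hn : 0 < n := pow_pos hp.pos _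
  haveI : NeZero n := ⟨hn.ne'⟩
  have hα : IsPrimitiveRoot α (p ^ (h + 1)) :=
    hζ.pow hn (by rw [hndef, ← pow_add]; congr 1; omega)
  have hβ : IsPrimitiveRoot β (p ^ h) :=
    hζ.pow hn (by rw [hndef, ← pow_add]; congr 1; omega)
  have hα0 : α ≠ 0 := hα.ne_zero (pow_ne_zero _ hp0)
  have hβ0 : β ≠ 0 := hβ.ne_zero (pow_ne_zero _ hp0)
  have hαn : α ^ n = 1 := by
    rw [hα.pow_eq_one_iff_dvd, hndef, add_assoc]
    exact pow_dvd_pow p (by omega)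
  have hxL : algebraMap K L x ≠ 0 := (map_ne_zero _).mpr hx
  have hy0 : y ≠ 0 := by
    rintro rfl
    rw [zero_pow hn.ne'] at hyx
    exact hxL hyx.symm
  have hβmem : β ∈ K⟮β⟯ := IntermediateField.mem_adjoin_simple_self K β
  have hαmem : α ∈ K⟮α⟯ := IntermediateField.mem_adjoin_simple_self K α
  -- Case 1: `α ∈ K(β)`, nothing to do
  by_cases hαF : α ∈ K⟮β⟯
  · exact ⟨y, (IntermediateField.adjoin_simple_le_iff.mpr hαF) hy, hyx⟩
  -- Case 2: an `s ∈ Gal(L/K(β))` moving `α`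
  obtain ⟨s, hsF, hsα⟩ : ∃ s : L ≃ₐ[K] L, s ∈ K⟮β⟯.fixingSubgroup ∧ s α ≠ α := by
    by_contra hall
    push Not at hall
    apply hαF
    rw [← IsGalois.fixedField_fixingSubgroup K⟮β⟯, IntermediateField.mem_fixedField_iff]
    exact hall
  have hsfix : ∀ z ∈ K⟮β⟯, s z = z := (IntermediateField.mem_fixingSubgroup_iff _ _).mp hsF
  have hsβ : s β = β := hsfix β hβmem
  -- `θ = s α / α`, a primitive `p`-th root of unity in `K(β)`, fixed by `s`
  obtain ⟨θ, hθdef⟩ : ∃ θ : L, θ = s α * α⁻¹ := ⟨_, rfl⟩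
  have hsαθ : s α = θ * α := by rw [hθdef, inv_mul_cancel_right₀ hα0]
  have hθp : θ ^ p = 1 := by
    rw [hθdef, mul_pow, ← map_pow, inv_pow, hαβ, hsβ, mul_inv_cancel₀ hβ0]
  have hθ1 : θ ≠ 1 := by
    intro h1
    apply hsα
    rw [hsαθ, h1, one_mul]
  have hθ : IsPrimitiveRoot θ p :=
    isPrimitiveRoot_of_mem_nthRootsFinset hp
      ((Polynomial.mem_nthRootsFinset hp.pos (1 : L)).mpr hθp) hθ1
  have hθ0 : θ ≠ 0 := hθ.ne_zero hp0
  have hζ₁ : IsPrimitiveRoot (β ^ p ^ (h - 1)) p :=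
    hβ.pow (pow_pos hp.pos _) (by rw [← pow_succ, Nat.sub_add_cancel hh])
  obtain ⟨i, -, hiθ⟩ := hζ₁.eq_pow_of_pow_eq_one hθp
  have hθF : θ ∈ K⟮β⟯ := by
    rw [← hiθ]
    exact pow_mem (pow_mem hβmem _) _
  have hsθ : s θ = θ := hsfix θ hθF
  -- `s y = η y` with `η = ζ ^ f`
  obtain ⟨η, hηdef⟩ : ∃ η : L, η = s y * y⁻¹ := ⟨_, rfl⟩
  have hsy : s y = η * y := by rw [hηdef, inv_mul_cancel_right₀ hy0]
  have hηn : η ^ n = 1 := by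
    rw [hηdef, mul_pow, ← map_pow, inv_pow, hyx, AlgEquiv.commutes, mul_inv_cancel₀ hxL]
  obtain ⟨f, -, hf⟩ := hζ.eq_pow_of_pow_eq_one hηn
  -- `s ζ = ζ ^ g` with `g ≡ 1 (mod p^h)`
  have hsζn : (s ζ) ^ n = 1 := by rw [← map_pow, hζ.pow_eq_one, map_one]
  obtain ⟨g, -, hg⟩ := hζ.eq_pow_of_pow_eq_one hsζn
  have hg1 : g ≡ 1 [MOD p ^ h] := by
    have h1 : β ^ g = β ^ 1 := by
      rw [pow_one, hβdef, ← pow_mul, mul_comm, pow_mul, hg, ← map_pow, ← hβdef, hsβ]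
    -- pass to the unit group, where `pow_eq_pow_iff_modEq` applies
    have hβu : IsPrimitiveRoot (Units.mk0 β hβ0) (p ^ h) := by
      rw [← IsPrimitiveRoot.coe_units_iff]
      exact hβ
    have h2 : (Units.mk0 β hβ0) ^ g = (Units.mk0 β hβ0) ^ 1 := by
      apply Units.ext
      rw [Units.val_pow_eq_pow_val, Units.val_pow_eq_pow_val, Units.val_mk0]
      exact h1
    rwa [pow_eq_pow_iff_modEq, ← hβu.eq_orderOf] at h2
  -- `s^k y = ζ^{f (1 + g + ⋯ + g^{k-1})} y`
  have hiter : ∀ k : ℕ, (s ^ k) y = ζ ^ (f * ∑ i ∈ Finset.range k, g ^ i) * y := by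
    intro k
    induction k with
    | zero => simp
    | succ k ih =>
      rw [pow_succ', AlgEquiv.mul_apply, ih, map_mul, map_pow, ← hg, hsy, ← hf, geom_sum_succ,
        ← pow_mul, ← mul_assoc, ← pow_add]
      congr 2
      ring
  -- `s^p` fixes `K(α)`, hence `y`
  have hspα : (s ^ p) α = α := by
    rw [Chevalley1951.algEquiv_pow_apply_of_apply_eq_mul hsαθ hsθ p, hθp, one_mul]
  have hspy : (s ^ p) y = y := Chevalley1951.algEquiv_apply_eq_self_of_apply_gen_eq hspα hy
  -- hence `n ∣ f (1 + g + ⋯ + g^{p-1})`, and `p^{h+e} ∣ f`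
  have hdvd : n ∣ f * ∑ i ∈ Finset.range p, g ^ i := by
    rw [← hζ.pow_eq_one_iff_dvd]
    have h1 := hiter p
    rw [hspy] at h1
    exact (mul_eq_right₀ hy0).mp h1.symm
  obtain ⟨S, hS, hScop⟩ := Chevalley1951.geom_sum_eq_prime_mul_coprime hp hh hh2 hg1
  have hfdvd : p ^ (h + e) ∣ f := by
    rw [hS, hndef] at hdvd
    have h1 : p ^ (h + e) * p ∣ f * S * p := by
      rw [← pow_succ, mul_assoc, mul_comm S p]
      convert hdvd using 2
      omega
    have h2 : p ^ (h + e) ∣ f * S := Nat.dvd_of_mul_dvd_mul_right hp.pos h1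
    exact (Nat.Coprime.pow_left (h + e) hScop.symm).dvd_of_dvd_mul_right h2
  -- so `η = ζ^f` is a `p`-th root of unity, `η = θ ^ j`
  have hηp : η ^ p = 1 := by
    rw [← hf, ← pow_mul, hζ.pow_eq_one_iff_dvd, hndef]
    obtain ⟨c, hc⟩ := hfdvd
    rw [hc]
    exact ⟨c, by ring⟩
  obtain ⟨j, -, hj⟩ := hθ.eq_pow_of_pow_eq_one hηp
  -- the corrected root `y' = y α^{-j}`
  have hsy' : s (y * (α ^ j)⁻¹) = y * (α ^ j)⁻¹ := by
    rw [map_mul, map_inv₀, map_pow, hsy, hsαθ, ← hj, mul_pow, mul_inv, mul_comm (θ ^ j) y,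
      mul_assoc, ← mul_assoc (θ ^ j), mul_inv_cancel₀ (pow_ne_zero _ hθ0), one_mul]
  have hy'mem : y * (α ^ j)⁻¹ ∈ K⟮α⟯ := mul_mem hy (inv_mem (pow_mem hαmem j))
  refine ⟨y * (α ^ j)⁻¹, ?_, ?_⟩
  · -- fixed by all of `Gal(L/K(β))`, hence in `K(β)`
    rw [← IsGalois.fixedField_fixingSubgroup K⟮β⟯, IntermediateField.mem_fixedField_iff]
    intro s' hs'
    have hs'β : s' β = β := (IntermediateField.mem_fixingSubgroup_iff _ _).mp hs' β hβmem
    have hθ'p : (s' α * α⁻¹) ^ p = 1 := by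
      rw [mul_pow, ← map_pow, inv_pow, hαβ, hs'β, mul_inv_cancel₀ hβ0]
    obtain ⟨k, -, hk⟩ := hθ.eq_pow_of_pow_eq_one hθ'p
    have hs'α : s' α = (s ^ k) α := by
      rw [Chevalley1951.algEquiv_pow_apply_of_apply_eq_mul hsαθ hsθ k, hk,
        inv_mul_cancel_right₀ hα0]
    rw [Chevalley1951.algEquiv_apply_eq_of_apply_gen_eq hs'α hy'mem]
    exact Chevalley1951.algEquiv_pow_apply_of_apply_eq_self hsy' k
  · rw [mul_pow, inv_pow, ← pow_mul, mul_comm j, pow_mul, hαn, one_pow, inv_one, mul_one, hyx]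

/-- **Iterated descent**: from `K(ζ)` down to `K(ζ_{h₀})`, `h₀ = 1` for odd `p` and `h₀ = 2` for
`p = 2` (Chevalley, p. 38: the steps `h ≥ 1`, "`h ≥ 2` si `p = 2`").  With `ζ` a primitive
`p^t`-th root of unity in `L` and `x ∈ Kˣ` a `p^t`-th power in `K(ζ)`: for every `j ≤ t - h₀`,
`x` is a `p^t`-th power in `K(ζ^{p^j})`. [cite: ChevalleyDeuxTheoremes1951, §4 (p. 38)] -/
theorem Chevalley1951.descent_iterate {p : ℕ} (hp : p.Prime) {t h₀ : ℕ} (hh₀ : 1 ≤ h₀)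
    (hh₀2 : p = 2 → 2 ≤ h₀) {ζ : L} (hζ : IsPrimitiveRoot ζ (p ^ t)) {x : K} (hx : x ≠ 0)
    (hyx : ∃ y ∈ K⟮ζ⟯, y ^ p ^ t = algebraMap K L x) {j : ℕ} (hj : j + h₀ ≤ t) :
    ∃ y ∈ K⟮ζ ^ p ^ j⟯, y ^ p ^ t = algebraMap K L x := by
  induction j with
  | zero => simpa using hyx
  | succ j ih =>
    obtain ⟨y, hy, hyx'⟩ := ih (by omega)
    -- apply the step with `h = t - 1 - j ≥ h₀`, `e = j`
    have ht : t = (t - 1 - j) + 1 + j := by omega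
    have hζ' : IsPrimitiveRoot ζ (p ^ ((t - 1 - j) + 1 + j)) := ht ▸ hζ
    obtain ⟨y', hy', hy'x⟩ := Chevalley1951.descent_step hp (h := t - 1 - j) (e := j)
      (by omega) (fun h2 => by have := hh₀2 h2; omega) hζ' hx hy (by rw [← ht]; exact hyx')
    exact ⟨y', hy', by rw [ht]; exact hy'x⟩

omit [FiniteDimensional K L] [IsGalois K L] in
/-- The degree of `K(α)/K` for a primitive `n`-th root of unity `α` is at most `φ(n)`
(`minpoly K α ∣ Φ_n`). [folklore] -/
theorem Chevalley1951.finrank_adjoin_primitiveRoot_le [CharZero K] {n : ℕ} (hn : 0 < n) {α : L}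
    (hα : IsPrimitiveRoot α n) : Module.finrank K K⟮α⟯ ≤ Nat.totient n := by
  haveI : CharZero L := charZero_of_injective_algebraMap (algebraMap K L).injective
  have hint : IsIntegral K α := (hα.isIntegral hn).tower_top
  rw [IntermediateField.adjoin.finrank hint, ← Polynomial.natDegree_cyclotomic n K]
  have hroot : (Polynomial.cyclotomic n K).aeval α = 0 := by
    rw [Polynomial.aeval_def, ← Polynomial.eval_map, Polynomial.map_cyclotomic,
      ← Polynomial.IsRoot.def, Polynomial.isRoot_cyclotomic_iff_charZero hn]
    exact hα
  exact Polynomial.natDegree_le_of_dvd (minpoly.dvd K α hroot) (Polynomial.cyclotomic_ne_zero n K)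

/-- **The weak Remarque** (Chevalley, p. 39, Remarque, in the form needed for units and without
the hypothesis "`-1` carré si `p = 2`"): inside a finite Galois extension `L/K` of fields of
characteristic zero, let `ζ` be a primitive `p^t`-th root of unity, `t ≥ 2`, and let `x ∈ Kˣ`
be a `p^t`-th power in `K(ζ)`.  Then `x = w^{p^{t-1}}` or `x = -w^{p^{t-1}}` for some `w ∈ K`.
Proof: descend to `K(ζ_p)` (resp. `K(ζ_4)` for `p = 2`) by `descent_iterate`, then take the norm
down to `K`: `x^d = z^{p^t}` with `d = [K(ζ_p):K] ≤ p - 1` prime to `p` (Bezout), resp.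
`d = [K(ζ_4):K] ≤ 2`, where `x^2 = (z^{2^{t-1}})^2` gives `x = ± z^{2^{t-1}}`.
[cite: ChevalleyDeuxTheoremes1951, §4 (pp. 38–39), Remarque (p. 39)] -/
theorem Chevalley1951.exists_eq_pow_or_eq_neg_pow_of_mem_adjoin [CharZero K] {p : ℕ}
    (hp : p.Prime) {t : ℕ} (ht : 2 ≤ t) {ζ : L} (hζ : IsPrimitiveRoot ζ (p ^ t)) {x : K}
    (hx : x ≠ 0) (hyx : ∃ y ∈ K⟮ζ⟯, y ^ p ^ t = algebraMap K L x) :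
    ∃ w : K, x = w ^ p ^ (t - 1) ∨ x = -w ^ p ^ (t - 1) := by
  have hp0 : p ≠ 0 := hp.ne_zero
  have hpt : 0 < p ^ t := pow_pos hp.pos t
  -- `h₀ = 1` (`p` odd) or `2` (`p = 2`)
  set h₀ : ℕ := if p = 2 then 2 else 1 with hh₀def
  have hh₀ : 1 ≤ h₀ := by rw [hh₀def]; split_ifs <;> omega
  have hh₀2 : p = 2 → 2 ≤ h₀ := fun h2 => by rw [hh₀def, if_pos h2]
  have hh₀t : h₀ ≤ t := by rw [hh₀def]; split_ifs <;> omega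
  -- descend to `F = K(ζ^{p^{t-h₀}}) = K(ζ_{h₀})`
  obtain ⟨y, hy, hyx'⟩ :=
    Chevalley1951.descent_iterate hp hh₀ hh₀2 hζ hx hyx (j := t - h₀) (by omega)
  set α : L := ζ ^ p ^ (t - h₀) with hαdef
  have hα : IsPrimitiveRoot α (p ^ h₀) :=
    hζ.pow hpt (by rw [← pow_add]; congr 1; omega)
  set F : IntermediateField K L := K⟮α⟯ with hFdef
  -- the norm of `y` from `F` to `K`
  set yF : F := ⟨y, hy⟩ with hyFdef
  have hyF : yF ^ p ^ t = algebraMap K F x := by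
    apply Subtype.ext
    rw [SubmonoidClass.coe_pow]
    exact hyx'
  set d : ℕ := Module.finrank K F with hddef
  set z : K := Algebra.norm K yF with hzdef
  have hz : z ^ p ^ t = x ^ d := by
    rw [hzdef, ← map_pow, hyF, Algebra.norm_algebraMap]
  have hd1 : 1 ≤ d := Module.finrank_pos
  have hdle : d ≤ Nat.totient (p ^ h₀) :=
    Chevalley1951.finrank_adjoin_primitiveRoot_le (pow_pos hp.pos _) hα
  by_cases h2 : p = 2
  · -- `p = 2`: `d ≤ φ(4) = 2`
    subst h2
    have hh₀2' : h₀ = 2 := by rw [hh₀def, if_pos rfl]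
    rw [hh₀2', show Nat.totient (2 ^ 2) = 2 by decide] at hdle
    have ht1 : 2 ^ t = 2 ^ (t - 1) * 2 := by rw [← pow_succ]; congr 1; omega
    interval_cases d
    · -- `d = 1`: `x = z ^ 2^t = (z^2)^(2^(t-1))`
      refine ⟨z ^ 2, Or.inl ?_⟩
      rw [pow_one] at hz
      rw [← hz, ← pow_mul, mul_comm, ht1]
    · -- `d = 2`: `x^2 = (z^(2^(t-1)))^2`
      refine ⟨z, ?_⟩
      have h1 : x ^ 2 = (z ^ 2 ^ (t - 1)) ^ 2 := by rw [← hz, ← pow_mul, ht1]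
      rcases sq_eq_sq_iff_eq_or_eq_neg.mp h1 with h | h
      · exact Or.inl h
      · exact Or.inr h
  · -- `p` odd: `d ≤ p - 1` is prime to `p`, Bezout
    have hh₀1 : h₀ = 1 := by rw [hh₀def, if_neg h2]
    rw [hh₀1, pow_one, Nat.totient_prime hp] at hdle
    have hcop : Nat.Coprime d (p ^ t) :=
      Nat.Coprime.pow_right t (Nat.coprime_of_lt_prime (by omega) (by omega) hp).symm
    obtain ⟨a, b, hab⟩ : IsCoprime (d : ℤ) (p ^ t : ℕ) := Nat.isCoprime_iff_coprime.mpr hcop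
    have hz0 : z ≠ 0 := by
      intro h0
      rw [h0, zero_pow hpt.ne'] at hz
      exact pow_ne_zero d hx hz.symm
    -- `x = x^(a d + b p^t) = (z^a x^b)^(p^t)`
    refine ⟨(z ^ a * x ^ b) ^ p, Or.inl ?_⟩
    rw [← zpow_natCast (_ ^ p), ← zpow_natCast (z ^ a * x ^ b), ← zpow_mul, ← Nat.cast_mul,
      ← pow_succ', Nat.sub_add_cancel (by omega : 1 ≤ t), mul_zpow, ← zpow_mul, ← zpow_mul,
      mul_comm a, zpow_mul, zpow_natCast, hz, ← zpow_natCast, ← zpow_mul, ← zpow_add₀ hx]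
    push_cast at hab ⊢
    rw [show ((d : ℤ) * a + b * (p : ℤ) ^ t) = 1 by linear_combination hab, zpow_one]

end Galois

/-! ### The unit version -/

section Units

open NumberField

variable {K L : Type*} [Field K] [NumberField K] [Field L] [Algebra K L]
  [FiniteDimensional K L] [IsGalois K L]

/-- **The weak Remarque for units** (Chevalley, p. 39, applied to the unit group, p. 36): inside
a finite Galois extension `L/K` of a number field `K`, let `ζ` be a primitive `p^t`-th root of
unity, `t ≥ 2`, and let `u` be a unit of `𝓞 K` which is a `p^t`-th power in `K(ζ)`.  Then
`u = ξ · w^{p^{t-1}}` with `w` a unit of `𝓞 K` and `ξ = ±1 ∈ μ(K)` (a `p^{t-1}`-th root of a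
unit of `𝓞 K` lying in `K` is an algebraic integer, hence a unit).
[cite: ChevalleyDeuxTheoremes1951, §4 (pp. 38–39), Remarque (p. 39)] -/
theorem Chevalley1951.exists_unit_eq_torsion_mul_pow {p : ℕ} (hp : p.Prime) {t : ℕ} (ht : 2 ≤ t)
    {ζ : L} (hζ : IsPrimitiveRoot ζ (p ^ t)) (u : (𝓞 K)ˣ)
    (hyx : ∃ y ∈ K⟮ζ⟯, y ^ p ^ t = algebraMap K L (algebraMap (𝓞 K) K u)) :
    ∃ (w : (𝓞 K)ˣ) (ξ : (𝓞 K)ˣ), ξ ∈ Units.torsion K ∧ u = ξ * w ^ p ^ (t - 1) := by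
  have hu0 : algebraMap (𝓞 K) K u ≠ 0 := RingOfIntegers.coe_ne_zero_iff.mpr (Units.ne_zero u)
  obtain ⟨w, hw⟩ := Chevalley1951.exists_eq_pow_or_eq_neg_pow_of_mem_adjoin hp ht hζ hu0 hyx
  have hm : 0 < p ^ (t - 1) := pow_pos hp.pos _
  -- `w` is an algebraic integer
  have hwn : w ^ p ^ (t - 1) = algebraMap (𝓞 K) K u ∨
      w ^ p ^ (t - 1) = -algebraMap (𝓞 K) K u := by
    rcases hw with h | h
    · exact Or.inl h.symm
    · exact Or.inr (by rw [h, neg_neg])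
  have hwint : IsIntegral ℤ w := by
    apply IsIntegral.of_pow hm
    rcases hwn with h | h
    · rw [h]; exact RingOfIntegers.isIntegral_coe _
    · rw [h]; exact (RingOfIntegers.isIntegral_coe _).neg
  obtain ⟨w', hw'⟩ : ∃ w' : 𝓞 K, algebraMap (𝓞 K) K w' = w := ⟨⟨w, hwint⟩, rfl⟩
  have hinj : Function.Injective (algebraMap (𝓞 K) K) := RingOfIntegers.coe_injective
  have hw'n : w' ^ p ^ (t - 1) = u ∨ w' ^ p ^ (t - 1) = -(u : 𝓞 K) := by
    rcases hwn with h | h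
    · left
      apply hinj
      rw [map_pow, hw', h]
    · right
      apply hinj
      rw [map_pow, map_neg, hw', h]
  have hw'unit : IsUnit w' := by
    rw [← isUnit_pow_iff hm.ne']
    rcases hw'n with h | h
    · rw [h]; exact Units.isUnit u
    · rw [h]; exact (Units.isUnit u).neg
  obtain ⟨wu, hwu⟩ := hw'unit
  have hneg1 : (-1 : (𝓞 K)ˣ) ∈ Units.torsion K := by
    rw [Units.torsion, CommGroup.mem_torsion, isOfFinOrder_iff_pow_eq_one]
    exact ⟨2, two_pos, by simp⟩
  rcases hw'n with h | h
  · refine ⟨wu, 1, one_mem _, ?_⟩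
    apply Units.ext
    rw [one_mul, Units.val_pow_eq_pow_val, hwu, h]
  · refine ⟨wu, -1, hneg1, ?_⟩
    apply Units.ext
    rw [Units.val_mul, Units.val_pow_eq_pow_val, hwu, h, Units.val_neg, Units.val_one]
    ring

end Units

end Literature.NumberTheory.NumberFields
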